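import Summits.QuantumFields.YangMills.Theorems.BalabanUVNodesPortS1ChartJacobianRecord
import Literature.MathematicalPhysics.QuantumFieldTheory.Balaban1983to89.Node00.SmallFieldChi29AxOfRecord
import Literature.MathematicalPhysics.QuantumFieldTheory.Balaban1983to89.T4ExpWindowSmallField
import Literature.MathematicalPhysics.QuantumFieldTheory.Balaban1983to89.B12SmallFieldDomain259

/-!
# BalabanUVNodes — port (S1), FE-1 brick (h1)∕R8: THE (2.9) WINDOW OF RECORD IN THE CHART — the record's cut-off `chiFix29AxOfRecord` (group distance `dist1`, centred at the
  block-axial `V^{(k)}_{ax}(V̄)`) READ ON THE FIBRE `V̄ = W` at a charted configuration `V = exp(iB′)·V^{(k)}_{ax}(W)` IS print's `Π_{b∉b₀} χ(|B′(b)| < ε₁)` with `ε₁ = 2·arcsin(ε₂₉∕2)`,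
  and in DEF-1's SCALED variable `B′ = g_k·x` it IS the socket cut-off ✓`chiFluctPrinted (2·arcsin(ε₂₉∕2)∕g_k)` (porter hand `hand-27930-FE-1` g0, cell `ym-nodeO-ideate`)

`--supports stmt-QuantumFields-27930` (helper; NO `--workitem`); count-neutral.  [I] = [Balaban1987RG1].

WHY.  FE-1's chart law (T1) ([I] (2.1) ↦ (2.10) ↦ (2.12)) compares the merged term of record, whose (2.9) cut-off is `chiβOfRecord₁₃Ax θ = chiFixed29Ax … θ.ε₂₉` ⇝
`chiFix29AxOfRecord ν ε₂₉ K k V = [∀ b, ¬IsB0 b → dist1 (V^{(k)}_{ax}(V̄)(b)⁻¹ · V b) < ε₂₉]` (`Node00/SmallFieldChi29AxOfRecord` :147 — the OPERATOR-NORM distance on `SU(2)`, UNSCALED), with DEF-1's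
closed carrier `recordFluctInt` (✓p828389), whose cut-off is `chiFluctPrinted ε₁` on the SCALED chart variable ((c3) of ✓p828316: print's (2.9) radius = `g_k·ε₁` there).  This file proves that
on the fibre the two cut-offs are THE SAME FUNCTION once `ε₁ := 2·arcsin(ε₂₉∕2)∕g_k` (◇ lens-1 g14 (D2) memo row R8, ▶ PT-A-1 `FE-SPLIT-PROPOSAL-v2` §3 (h1)) — the window dictionary
of the FE-1 letter; nothing else.
* §1 `dist1_expPauli : dist1 (expPauli A) = 2·|sin(‖A‖∕2)|` (✓`T4ExpWindowSmallField.dist1_expPoint_eq` through ✓`expPauli_eq_expPoint`); `dist1_inv_mul_chartAt` (conjugation invariance);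
  `two_mul_abs_sin_half_lt_iff : 0 ≤ r ≤ π → 0 ≤ ε ≤ 2 → (2|sin(r∕2)| < ε ↔ r < 2·arcsin(ε∕2))`.
* §2 AT THE RECORD: ★ `fluctDevAxOfRecord_eq_of_chart` — on the fibre `V̄ = W`, at `V b = pert … (V^{(k)}_{ax}(W)) Y b`: `fluctDevAx … V b = 2|sin(‖Y_b‖∕2)|`; ★★ `chiFix29AxOfRecord_eq_of_chart` —
  `χ^{(2.9)}_{k,ax}(V) = [∀ b ∉ b₀, 2|sin(‖Y_b‖∕2)| < ε₂₉]`; ★★★ `chiFix29AxOfRecord_eq_chiFluctPrinted` — if off `b₀` the chart variable is `Y_b = g·x_b` inside the injectivity window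
  `g·‖x_b‖ ≤ π`, `0 < g`, `0 < ε₂₉ ≤ 2`, then `χ^{(2.9)}_{k,ax}(V) = chiFluctPrinted (2·arcsin(ε₂₉∕2)∕g) (fluctVec F k K x)` — W-INDEPENDENT, `b₀`-rows unread on both sides (FE-1's design word
  (D1) confirmed by name), the radius HISTORY-DEPENDENT through `g = v (Fin.last k)`.
DEDUP: `dist1_expPauli`, `dist1_inv_mul_chartAt`, `two_mul_abs_sin_half_lt_iff`, `fluctDevAxOfRecord_eq_of_chart`, `chiFix29AxOfRecord_eq_of_chart`, `chiFix29AxOfRecord_eq_chiFluctPrinted`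
— 0 tree hits (`rg -ow`); proofs only, no definitions (the radius NAME `feChartRadius ε₂₉ g := 2·arcsin(ε₂₉∕2)∕g` goes with the FE-1 letter, not here); `dist1_expPoint_eq`, `expPauli_eq_expPoint`, `norm_rev`, `pert_apply_eq_chartAt`, `fluctVec`, `chiFluctPrinted`, `IsB0` IMPORTED by name.

HONEST STATUS.  A window dictionary (folklore trigonometry + conjugation invariance + unfolding); NOTHING of Bałaban's (2.10)–(2.14) chart law, exponent algebra or cluster expansion is
asserted, ported or discharged; `stub_FE` ∕ `stub_P0C` OPEN; ⟨27930⟩ OPEN (1∕3); NODE O 0∕1; COUNT 8∕28 · K 1∕4 UNMOVED; finite 𝕋⁴_{L^K} at fixed ε — NOT continuum ∕ OS ∕ Clay;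
**the Yang–Mills mass gap (Clay) is NOT proved by any of this.**  No `sorry`; standard axioms.

References: T. Bałaban, *Renormalization group approach to lattice gauge field theories. I*, Comm. Math. Phys. 109 (1987) 249–301 [Balaban1987RG1] — (2.9) p.266, (2.4) p.266, (2.3) p.265, p.267.
-/

noncomputable section

open Set Metric NormedSpace

namespace Summit.QuantumFields.YangMills.Theorems.BalabanUVNodesPortS1

open Summit.QuantumFields.YangMills.Theorems.K0RecordFormatNames (FluctIdx fluctMat pert)
open Literature.MathematicalPhysics.QuantumFieldTheory.Balaban1983to89
open Literature.MathematicalPhysics.QuantumFieldTheory.Balaban1983to89.Node00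
open Literature.MathematicalPhysics.QuantumFieldTheory.Balaban1983to89.T4Continuum (T4Family)
open Literature.MathematicalPhysics.QuantumFieldTheory.Balaban1983to89.B10Eq18SigmaSU2Haar (expPauli expPauli_eq_expPoint norm_rev)
open Literature.MathematicalPhysics.QuantumFieldTheory.Balaban1983to89.T4ExpWindowSmallField (dist1_expPoint_eq)
open Literature.MathematicalPhysics.QuantumFieldTheory.Balaban1983to89.B12SmallFieldDomain259 (chiFluctPrinted)

/-! ## §1  The chord formula for the Pauli chart and the window dictionary -/

/-- **`dist1 (exp iA) = 2|sin(|A|∕2)|`** for print's Pauli chart (the operator-norm distance to `1` on `SU(2)`; ✓`dist1_expPoint_eq` read through ✓`expPauli_eq_expPoint`).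
[cite: Balaban1987RG1, (2.4) p.266, (2.9) p.266] -/
theorem dist1_expPauli (A : EuclideanSpace ℝ (Fin 3)) : dist1 (expPauli A) = 2 * |Real.sin (‖A‖ / 2)| := by
  rw [expPauli_eq_expPoint, dist1_expPoint_eq, norm_rev]

/-- `dist1 (u⁻¹ · (exp iA · u)) = 2|sin(|A|∕2)|` — the centre of the chart drops out by conjugation invariance of `dist1`. [cite: Balaban1987RG1, (2.9) p.266 (bookkeeping)] -/
theorem dist1_inv_mul_chartAt (u : Matrix.specialUnitaryGroup (Fin 2) ℂ) (A : EuclideanSpace ℝ (Fin 3)) :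
    dist1 (u⁻¹ * chartAt u A) = 2 * |Real.sin (‖A‖ / 2)| := by
  rw [chartAt_apply, ← mul_assoc, show u⁻¹ * expPauli A * u = u⁻¹ * expPauli A * u⁻¹⁻¹ by rw [inv_inv], GaugeGroup.dist1_conj,
    dist1_expPauli]

/-- **THE WINDOW DICTIONARY** (one bond): for `0 ≤ r ≤ π` and `0 ≤ ε ≤ 2`, `2|sin(r∕2)| < ε ↔ r < 2·arcsin(ε∕2)`. [cite: Balaban1987RG1, (2.9) p.266 (bookkeeping)] -/
theorem two_mul_abs_sin_half_lt_iff {r ε : ℝ} (hr₀ : 0 ≤ r) (hrπ : r ≤ Real.pi) (hε₀ : 0 ≤ ε) (hε₂ : ε ≤ 2) :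
    2 * |Real.sin (r / 2)| < ε ↔ r < 2 * Real.arcsin (ε / 2) := by
  have hsin : 0 ≤ Real.sin (r / 2) :=
    Real.sin_nonneg_of_nonneg_of_le_pi (by linarith) (by linarith [Real.pi_pos])
  rw [abs_of_nonneg hsin]
  have hx : r / 2 ∈ Icc (-(Real.pi / 2)) (Real.pi / 2) := ⟨by linarith [Real.pi_pos], by linarith⟩
  have hy : ε / 2 ∈ Icc (-1 : ℝ) 1 := ⟨by linarith, by linarith⟩
  have key := Real.lt_arcsin_iff_sin_lt hx hy
  constructor
  · intro h
    have h' : Real.sin (r / 2) < ε / 2 := by linarith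
    have := key.mpr h'
    linarith
  · intro h
    have h' : r / 2 < Real.arcsin (ε / 2) := by linarith
    have := key.mp h'
    linarith

/-! ## §2  At the record: the cut-off of record on the fibre, in the chart -/

variable (F : T4Family)

/-- ★ **THE FLUCTUATION DEVIATION OF RECORD IN THE CHART, ON THE FIBRE**: if `V̄ = W` and `V b = exp(iY_b)·V^{(k)}_{ax}(W)(b)` (`= pert … (critCfgAxOfRecord … W) Y b`), then
`fluctDevAx … V b = dist1 (V^{(k)}_{ax}(V̄)(b)⁻¹ V b) = 2|sin(‖Y_b‖∕2)|` — the centre `V^{(k)}_{ax}` drops out. [cite: Balaban1987RG1, (2.9) p.266, (2.3)–(2.4) pp.265–266] -/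
theorem fluctDevAxOfRecord_eq_of_chart (ν : Stage7Numerics) {K k : ℕ} {W : GaugeField (F.P K) (k + 1) (SU 2)} {V : GaugeField (F.P K) k (SU 2)}
    (hfib : (avOfRecord F 2 K k).avg V = W) {Y : FluctIdx F k K → ℝ} {b : PBond (F.P K) k}
    (hb : V b = pert F k K (critCfgAxOfRecord F 2 ν K k W) Y b) :
    fluctDevAxOfRecord F 2 ν K k V b = 2 * |Real.sin (‖fluctVec F k K Y b‖ / 2)| := by
  rw [fluctDevAxOfRecord_apply, hfib, hb, pert_apply_eq_chartAt]
  exact dist1_inv_mul_chartAt _ _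

open Classical in
/-- ★★ **THE (2.9) CUT-OFF OF RECORD IN THE CHART, ON THE FIBRE**: if `V̄ = W` and `V` agrees OFF the distinguished bonds `b₀(c)` with the charted configuration `pert … (V^{(k)}_{ax}(W)) Y`, then
`χ^{(2.9)}_{k,ax}(V) = [∀ b ∉ b₀, 2|sin(‖Y_b‖∕2)| < ε₂₉]` (the `b₀`-rows are unread — design word (D1)). [cite: Balaban1987RG1, (2.9) p.266] -/
theorem chiFix29AxOfRecord_eq_of_chart (ν : Stage7Numerics) (ε₂₉ : ℝ) {K k : ℕ} {W : GaugeField (F.P K) (k + 1) (SU 2)} {V : GaugeField (F.P K) k (SU 2)}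
    (hfib : (avOfRecord F 2 K k).avg V = W) {Y : FluctIdx F k K → ℝ}
    (hV : ∀ b : PBond (F.P K) k, ¬ IsB0 b → V b = pert F k K (critCfgAxOfRecord F 2 ν K k W) Y b) :
    chiFix29AxOfRecord F 2 ν ε₂₉ K k V =
      if ∀ b : PBond (F.P K) k, ¬ IsB0 b → 2 * |Real.sin (‖fluctVec F k K Y b‖ / 2)| < ε₂₉ then 1 else 0 := by
  unfold chiFix29AxOfRecord
  have hiff : (∀ b : PBond (F.P K) k, ¬ IsB0 b → fluctDevAxOfRecord F 2 ν K k V b < ε₂₉) ↔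
      (∀ b : PBond (F.P K) k, ¬ IsB0 b → 2 * |Real.sin (‖fluctVec F k K Y b‖ / 2)| < ε₂₉) := by
    refine forall_congr' fun b => imp_congr_right fun hb => ?_
    rw [fluctDevAxOfRecord_eq_of_chart F ν hfib (hV b hb)]
  simp only [hiff]

open Classical in
/-- ★★★ **THE (2.9) CUT-OFF OF RECORD IS THE SOCKET CUT-OFF `chiFluctPrinted` AT THE HISTORY-DEPENDENT RADIUS `2·arcsin(ε₂₉∕2)∕g`** ([I] (2.9) «χ_k = Π_{b∉b₀(c)} χ({|B′(b)| < ε₁})»,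
p.268 «B = g_kB′»): on the fibre `V̄ = W`, if OFF `b₀` the configuration is charted by `Y_b = g·x_b` (`V b = pert … (V^{(k)}_{ax}(W)) Y b`) with the scaled variable inside the injectivity window
(`g·‖x_b‖ ≤ π`), `0 < g`, `0 < ε₂₉ ≤ 2`, then `χ^{(2.9)}_{k,ax}(V) = chiFluctPrinted (2 * Real.arcsin (ε₂₉ / 2) / g) (fluctVec F k K x)`.  The window dictionary of the FE-1 letter; W drops out; the
`b₀`-rows are unread on both sides. [cite: Balaban1987RG1, (2.9) p.266, p.267 L1–3, p.268] -/
theorem chiFix29AxOfRecord_eq_chiFluctPrinted (ν : Stage7Numerics) {ε₂₉ g : ℝ} (hε₀ : 0 < ε₂₉) (hε₂ : ε₂₉ ≤ 2) (hg : 0 < g)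
    {K k : ℕ} {W : GaugeField (F.P K) (k + 1) (SU 2)} {V : GaugeField (F.P K) k (SU 2)}
    (hfib : (avOfRecord F 2 K k).avg V = W) {Y x : FluctIdx F k K → ℝ}
    (hV : ∀ b : PBond (F.P K) k, ¬ IsB0 b → V b = pert F k K (critCfgAxOfRecord F 2 ν K k W) Y b)
    (hY : ∀ b : PBond (F.P K) k, ¬ IsB0 b → ∀ a : Fin 3, Y (b, a) = g * x (b, a))
    (hwin : ∀ b : PBond (F.P K) k, ¬ IsB0 b → g * ‖fluctVec F k K x b‖ ≤ Real.pi) :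
    chiFix29AxOfRecord F 2 ν ε₂₉ K k V = chiFluctPrinted (2 * Real.arcsin (ε₂₉ / 2) / g) (fluctVec F k K x) := by
  rw [chiFix29AxOfRecord_eq_of_chart F ν ε₂₉ hfib hV]
  have hnorm : ∀ b : PBond (F.P K) k, ¬ IsB0 b → ‖fluctVec F k K Y b‖ = g * ‖fluctVec F k K x b‖ := by
    intro b hb
    have hvec : fluctVec F k K Y b = g • fluctVec F k K x b := by
      ext a
      rw [fluctVec_apply, PiLp.smul_apply, fluctVec_apply, smul_eq_mul, hY b hb a]
    rw [hvec, norm_smul, Real.norm_eq_abs, abs_of_pos hg]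
  have hiff : (∀ b : PBond (F.P K) k, ¬ IsB0 b → 2 * |Real.sin (‖fluctVec F k K Y b‖ / 2)| < ε₂₉) ↔
      (∀ b : PBond (F.P K) k, ¬ IsB0 b → ‖fluctVec F k K x b‖ < 2 * Real.arcsin (ε₂₉ / 2) / g) := by
    refine forall_congr' fun b => imp_congr_right fun hb => ?_
    rw [hnorm b hb, two_mul_abs_sin_half_lt_iff (by positivity) (hwin b hb) hε₀.le hε₂, lt_div_iff₀ hg, mul_comm]
  unfold chiFluctPrinted
  by_cases h : ∀ b : PBond (F.P K) k, ¬ IsB0 b → 2 * |Real.sin (‖fluctVec F k K Y b‖ / 2)| < ε₂₉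
  · rw [if_pos h, if_pos]
    exact fun b hb => hiff.mp h b hb
  · rw [if_neg h, if_neg]
    exact fun h' => h (hiff.mpr fun b hb => h' b hb)

-- standard axioms only
#print axioms chiFix29AxOfRecord_eq_chiFluctPrinted

end Summit.QuantumFields.YangMills.Theorems.BalabanUVNodesPortS1

end
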